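import Literature.NumberTheory.Sieve.Maynard2016Lemma7ClassSplit

/-!
# Maynard (2016), Lemma 7 — the error terms of the class-restricted `q`-sums

J. Maynard, *Large gaps between primes*, Ann. of Math. 183 (2016), §6, proof of Lemma 7, the
paragraph before (6.33) together with displays (6.29)–(6.31): the error terms of the `q`-sums
restricted to a class `q ≡ c (mod p)`, `p` a mid prime, have moduli `r_p = rad(p · ∏)` which are
`≤ y · x^{1/5} y^{2k} ≤ x^{1/4}`; each `r` arises from `≪ (2^{4k+1})^{ω(r)}` pairs `(p, tuple)`, and the
weights `|λλ'|/p` are bounded, so Bombieri–Vinogradov gives `Σ_p (1/p) Σ_tuples |λλ'| E*(x; r_p)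
≪_A x (log x)^{−A}`.

* `radP_eq_rad_prod` — `r_p = rad(p · ∏_j d_j d'_j e_j e'_j)` (non-zero coordinates);
* `classErrorSum_le_of_abs_lam_le` — the regrouping by `r`, for any finite set `P` of primes `≤ y`;
* `exists_eventually_classErrorSum_le` — the Bombieri–Vinogradov conclusion.

## References

* J. Maynard, *Large gaps between primes*, Ann. of Math. (2) 183 (2016), 915–933; arXiv:1408.5110,
  §6, proof of Lemma 7, displays (6.29)–(6.31) and the paragraph before (6.33). [Maynard2016LargeGaps]
-/

noncomputable section

open Finset Filter
open scoped BigOperators ArithmeticFunction.omega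

namespace Literature.NumberTheory.Sieve

namespace Maynard2016

variable {k : ℕ}

/-- `r_p = rad(p · ∏_j d_j · ∏_j d'_j · ∏_j e_j · ∏_j e'_j)` (prime `p`, non-zero coordinates).
[cite: Maynard2016LargeGaps, Lemma 7 (proof, display (6.28) and before (6.33))] -/
theorem radP_eq_rad_prod {p : ℕ} (hp : p.Prime) {d d' e e' : Fin k → ℕ} (hd0 : ∀ j, d j ≠ 0)
    (hd0' : ∀ j, d' j ≠ 0) (he0 : ∀ j, e j ≠ 0) (he0' : ∀ j, e' j ≠ 0) :
    radP p d d' e e' =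
      ∏ q ∈ (p * ((∏ j, d j) * (∏ j, d' j) * ((∏ j, e j) * ∏ j, e' j))).primeFactors, q := by
  have hN1 : (∏ t, sysD d d' e e' t) ≠ 0 := by
    rw [prod_sysD]
    exact Nat.mul_ne_zero (Finset.prod_ne_zero_iff.2 fun j _ => Nat.lcm_ne_zero (hd0 j) (hd0' j))
      (Finset.prod_ne_zero_iff.2 fun j _ => Nat.lcm_ne_zero (he0 j) (he0' j))
  have hN2 : (∏ j, d j) * (∏ j, d' j) * ((∏ j, e j) * ∏ j, e' j) ≠ 0 :=
    Nat.mul_ne_zero (Nat.mul_ne_zero (Finset.prod_ne_zero_iff.2 fun j _ => hd0 j)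
      (Finset.prod_ne_zero_iff.2 fun j _ => hd0' j))
      (Nat.mul_ne_zero (Finset.prod_ne_zero_iff.2 fun j _ => he0 j)
        (Finset.prod_ne_zero_iff.2 fun j _ => he0' j))
  rw [radP, Nat.primeFactors_mul hp.ne_zero hN1, Nat.primeFactors_mul hp.ne_zero hN2,
    primeFactors_prod_sysD hd0 hd0' he0 he0']

/-- Coordinates of a box element are `≥ 1`. [folklore] -/
private theorem one_le_of_mem_box'' {X : ℕ} {d : Fin k → ℕ} (hd : d ∈ box k X) (ℓ : Fin k) :
    1 ≤ d ℓ :=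
  (Finset.mem_Icc.1 (Fintype.mem_piFinset.1 hd ℓ)).1

/-- **The class error sums regrouped by `r` ((6.29)–(6.31) with the extra modulus `p`).**  For any
bound `|λ_{d,e}| ≤ Λ` and any finite set `P` of primes `≤ y`:
`Σ_{p ∈ P} (1/p) Σ_{d,d',e,e' ∈ rbox} |λ_{d,e} λ_{d',e'}| · 2E*(X; r_p)
 ≤ Λ² Σ_{r ≤ x^{1/5} y^{2(k+1)}, r squarefree} (2^{4k+1})^{ω(r)} · 2E*(X; r)`.
[cite: Maynard2016LargeGaps, Lemma 7 (proof, displays (6.29)–(6.31) and before (6.33))] -/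
theorem classErrorSum_le_of_abs_lam_le {J : ℕ} {c : Fin J → ℝ} {Fd : Fin k → Fin J → ℝ → ℝ}
    {G : ℝ → ℝ} (hD : IsSieveData k J c Fd G) {ε : ℝ} {x : ℕ} (hlogx : 0 < Real.log x)
    (hlogy : 0 < Real.log (y ε x)) (i : Fin k) (X : ℕ) {Λ : ℝ} (hΛ0 : 0 ≤ Λ)
    (hΛ : ∀ d e : Fin k → ℕ, |lam c Fd G ε x d e| ≤ Λ) (P : Finset ℕ)
    (hP : ∀ p ∈ P, p.Prime ∧ (p : ℝ) ≤ y ε x) :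
    ∑ p ∈ P, (1 / (p : ℝ)) * ∑ d ∈ rbox k x i, ∑ d' ∈ rbox k x i, ∑ e ∈ rbox k x i,
        ∑ e' ∈ rbox k x i, |lam c Fd G ε x d e * lam c Fd G ε x d' e'| *
          (2 * primeCountingAPErrMax X (radP p d d' e e')) ≤
      Λ ^ 2 * ∑ r ∈ (Finset.Icc 1 ⌊(x : ℝ) ^ (1 / 5 : ℝ) * y ε x ^ (2 * (k + 1))⌋₊).filter
        Squarefree, ((2 : ℝ) ^ (4 * k + 1)) ^ ω r * (2 * primeCountingAPErrMax X r) := by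
  classical
  have hx1 : (1 : ℝ) < x := by
    by_contra h
    push Not at h
    exact absurd (Real.log_nonpos (Nat.cast_nonneg _) h) (not_le.2 hlogx)
  have hx0 : (0 : ℝ) < x := by linarith
  have hy0 : 0 ≤ y ε x := (Real.exp_pos _).le
  have hy1 : 1 ≤ y ε x := by
    by_contra h
    push Not at h
    exact absurd (Real.log_nonpos hy0 h.le) (not_le.2 hlogy)
  -- the nested sum as a sum over the product finset
  set T := P ×ˢ (rbox k x i ×ˢ (rbox k x i ×ˢ (rbox k x i ×ˢ rbox k x i))) with hT
  set F : ℕ × (Fin k → ℕ) × (Fin k → ℕ) × (Fin k → ℕ) × (Fin k → ℕ) → ℝ := fun a =>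
    |lam c Fd G ε x a.2.1 a.2.2.2.1 * lam c Fd G ε x a.2.2.1 a.2.2.2.2 / a.1| *
      (2 * primeCountingAPErrMax X (radP a.1 a.2.1 a.2.2.1 a.2.2.2.1 a.2.2.2.2)) with hF
  have hFp : ∀ a ∈ T, F a = (1 / (a.1 : ℝ)) *
      (|lam c Fd G ε x a.2.1 a.2.2.2.1 * lam c Fd G ε x a.2.2.1 a.2.2.2.2| *
        (2 * primeCountingAPErrMax X (radP a.1 a.2.1 a.2.2.1 a.2.2.2.1 a.2.2.2.2))) := by
    intro a ha
    have hp : 0 < (a.1 : ℝ) := by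
      rw [hT, Finset.mem_product] at ha
      exact_mod_cast (hP a.1 ha.1).1.pos
    simp only [hF]
    rw [abs_div, abs_of_pos hp]
    ring
  have h1 : ∑ p ∈ P, (1 / (p : ℝ)) * ∑ d ∈ rbox k x i, ∑ d' ∈ rbox k x i, ∑ e ∈ rbox k x i,
      ∑ e' ∈ rbox k x i, |lam c Fd G ε x d e * lam c Fd G ε x d' e'| *
        (2 * primeCountingAPErrMax X (radP p d d' e e')) = ∑ a ∈ T, F a := by
    rw [Finset.sum_congr rfl hFp, hT, Finset.sum_product]
    refine Finset.sum_congr rfl fun p _ => ?_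
    rw [Finset.mul_sum, Finset.sum_product]
    refine Finset.sum_congr rfl fun d _ => ?_
    rw [Finset.mul_sum, Finset.sum_product]
    refine Finset.sum_congr rfl fun d' _ => ?_
    rw [Finset.mul_sum, Finset.sum_product]
    refine Finset.sum_congr rfl fun e _ => ?_
    rw [Finset.mul_sum]
  rw [h1]
  -- restrict to the support of `λλ'`
  set S := T.filter (fun a => lam c Fd G ε x a.2.1 a.2.2.2.1 * lam c Fd G ε x a.2.2.1 a.2.2.2.2 ≠ 0)
    with hS
  have h2 : ∑ a ∈ T, F a = ∑ a ∈ S, F a := by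
    rw [hS, Finset.sum_filter_of_ne]
    intro a _ hne h0
    apply hne
    simp only [hF, h0, zero_div, abs_zero, zero_mul]
  rw [h2]
  have hmem : ∀ a ∈ S, (a.1 ∈ P ∧ a.2.1 ∈ rbox k x i ∧ a.2.2.1 ∈ rbox k x i ∧
      a.2.2.2.1 ∈ rbox k x i ∧ a.2.2.2.2 ∈ rbox k x i) ∧
        lam c Fd G ε x a.2.1 a.2.2.2.1 ≠ 0 ∧ lam c Fd G ε x a.2.2.1 a.2.2.2.2 ≠ 0 := by
    intro a ha
    rw [hS, Finset.mem_filter, hT, Finset.mem_product, Finset.mem_product, Finset.mem_product,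
      Finset.mem_product] at ha
    exact ⟨⟨ha.1.1, ha.1.2.1, ha.1.2.2.1, ha.1.2.2.2.1, ha.1.2.2.2.2⟩, (mul_ne_zero_iff.1 ha.2).1,
      (mul_ne_zero_iff.1 ha.2).2⟩
  -- the coordinates, with the extra coordinate `p`
  set coord : ℕ × (Fin k → ℕ) × (Fin k → ℕ) × (Fin k → ℕ) × (Fin k → ℕ) →
      Option ((Fin k ⊕ Fin k) ⊕ (Fin k ⊕ Fin k)) → ℕ :=
    fun a t => t.elim a.1 (Sum.elim (Sum.elim a.2.1 a.2.2.1) (Sum.elim a.2.2.2.1 a.2.2.2.2))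
    with hcoord
  have hprod : ∀ a, ∏ t, coord a t =
      a.1 * ((∏ j, a.2.1 j) * (∏ j, a.2.2.1 j) * ((∏ j, a.2.2.2.1 j) * ∏ j, a.2.2.2.2 j)) := by
    intro a
    rw [Fintype.prod_option]
    simp only [hcoord, Option.elim_none, Option.elim_some, Fintype.prod_sum_type, Sum.elim_inl,
      Sum.elim_inr]
  have hne0 : ∀ a ∈ S, (∀ j, a.2.1 j ≠ 0) ∧ (∀ j, a.2.2.1 j ≠ 0) ∧ (∀ j, a.2.2.2.1 j ≠ 0) ∧
      (∀ j, a.2.2.2.2 j ≠ 0) := by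
    intro a ha
    obtain ⟨-, hl, hl'⟩ := hmem a ha
    exact ⟨fun j => (squarefree_of_lam_ne_zero hl j).1.ne_zero,
      fun j => (squarefree_of_lam_ne_zero hl' j).1.ne_zero,
      fun j => (squarefree_of_lam_ne_zero hl j).2.ne_zero,
      fun j => (squarefree_of_lam_ne_zero hl' j).2.ne_zero⟩
  have hF' : ∀ a ∈ S, F a = |lam c Fd G ε x a.2.1 a.2.2.2.1 * lam c Fd G ε x a.2.2.1 a.2.2.2.2 / a.1| *
      (2 * primeCountingAPErrMax X (∏ q ∈ (∏ t, coord a t).primeFactors, q)) := by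
    intro a ha
    obtain ⟨h0, h0', h0e, h0e'⟩ := hne0 a ha
    have hp : (a.1).Prime := (hP a.1 (hmem a ha).1.1).1
    simp only [hF]
    rw [hprod a, ← radP_eq_rad_prod hp h0 h0' h0e h0e']
  rw [Finset.sum_congr rfl hF']
  -- hypotheses of the regrouping lemma
  have hsq : ∀ a ∈ S, ∀ t, Squarefree (coord a t) := by
    intro a ha
    obtain ⟨⟨hpP, -⟩, hl, hl'⟩ := hmem a ha
    rintro (_ | ((j | j) | (j | j)))
    · simpa [hcoord] using (hP a.1 hpP).1.squarefree
    · simpa [hcoord] using (squarefree_of_lam_ne_zero hl j).1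
    · simpa [hcoord] using (squarefree_of_lam_ne_zero hl' j).1
    · simpa [hcoord] using (squarefree_of_lam_ne_zero hl j).2
    · simpa [hcoord] using (squarefree_of_lam_ne_zero hl' j).2
  have hM : ∀ a ∈ S, ∏ t, coord a t ≤ ⌊(x : ℝ) ^ (1 / 5 : ℝ) * y ε x ^ (2 * (k + 1))⌋₊ := by
    intro a ha
    obtain ⟨⟨hpP, hd, hd', -, -⟩, hl, hl'⟩ := hmem a ha
    have hpy : (a.1 : ℝ) ≤ y ε x := (hP a.1 hpP).2
    have hdb := rbox_subset_box k x i hd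
    have hdb' := rbox_subset_box k x i hd'
    have h1 := prod_le_rpow_tenth_of_lam_ne_zero hD hlogx (one_le_of_mem_box'' hdb) hl
    have h2 := prod_le_rpow_tenth_of_lam_ne_zero hD hlogx (one_le_of_mem_box'' hdb') hl'
    have h3 := prod_le_pow_of_lam_ne_zero hD hlogy hl
    have h4 := prod_le_pow_of_lam_ne_zero hD hlogy hl'
    refine Nat.le_floor ?_
    rw [hprod a]
    push_cast
    have h15 : (x : ℝ) ^ (1 / 10 : ℝ) * (x : ℝ) ^ (1 / 10 : ℝ) = (x : ℝ) ^ (1 / 5 : ℝ) := by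
      rw [← Real.rpow_add hx0]; norm_num
    have hyk : y ε x * (y ε x ^ k * y ε x ^ k) ≤ y ε x ^ (2 * (k + 1)) := by
      have : y ε x * (y ε x ^ k * y ε x ^ k) = y ε x ^ (2 * k + 1) := by ring
      rw [this]
      exact pow_le_pow_right₀ hy1 (by omega)
    have hx10 : 0 ≤ (x : ℝ) ^ (1 / 10 : ℝ) := Real.rpow_nonneg hx0.le _
    have hP0 : ∀ f : Fin k → ℕ, (0 : ℝ) ≤ ∏ j, (f j : ℝ) := fun f =>
      Finset.prod_nonneg fun j _ => Nat.cast_nonneg _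
    have hdd : (∏ j, (a.2.1 j : ℝ)) * ∏ j, (a.2.2.1 j : ℝ) ≤ (x : ℝ) ^ (1 / 5 : ℝ) := by
      rw [← h15]; exact mul_le_mul h1 h2 (hP0 _) hx10
    have hee : (∏ j, (a.2.2.2.1 j : ℝ)) * ∏ j, (a.2.2.2.2 j : ℝ) ≤ y ε x ^ k * y ε x ^ k :=
      mul_le_mul h3 h4 (hP0 _) (pow_nonneg hy0 _)
    calc (a.1 : ℝ) * ((∏ j, (a.2.1 j : ℝ)) * (∏ j, (a.2.2.1 j : ℝ)) *
          ((∏ j, (a.2.2.2.1 j : ℝ)) * ∏ j, (a.2.2.2.2 j : ℝ)))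
        ≤ y ε x * ((x : ℝ) ^ (1 / 5 : ℝ) * (y ε x ^ k * y ε x ^ k)) :=
          mul_le_mul hpy (mul_le_mul hdd hee (mul_nonneg (hP0 _) (hP0 _))
            (Real.rpow_nonneg hx0.le _)) (mul_nonneg (mul_nonneg (hP0 _) (hP0 _))
              (mul_nonneg (hP0 _) (hP0 _))) hy0
      _ = (x : ℝ) ^ (1 / 5 : ℝ) * (y ε x * (y ε x ^ k * y ε x ^ k)) := by ring
      _ ≤ (x : ℝ) ^ (1 / 5 : ℝ) * y ε x ^ (2 * (k + 1)) :=
          mul_le_mul_of_nonneg_left hyk (Real.rpow_nonneg hx0.le _)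
  have hinj : Set.InjOn coord S := by
    intro a _ b _ h
    have h0 : a.1 = b.1 := by simpa [hcoord] using congrFun h none
    have h1 : a.2.1 = b.2.1 := funext fun j => by
      simpa [hcoord] using congrFun h (some (Sum.inl (Sum.inl j)))
    have h2 : a.2.2.1 = b.2.2.1 := funext fun j => by
      simpa [hcoord] using congrFun h (some (Sum.inl (Sum.inr j)))
    have h3 : a.2.2.2.1 = b.2.2.2.1 := funext fun j => by
      simpa [hcoord] using congrFun h (some (Sum.inr (Sum.inl j)))
    have h4 : a.2.2.2.2 = b.2.2.2.2 := funext fun j => by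
      simpa [hcoord] using congrFun h (some (Sum.inr (Sum.inr j)))
    exact Prod.ext h0 (Prod.ext h1 (Prod.ext h2 (Prod.ext h3 h4)))
  have hf : ∀ r : ℕ, 0 ≤ 2 * primeCountingAPErrMax X r := fun r =>
    mul_nonneg zero_le_two (primeCountingAPErrMax_nonneg X r)
  have hw : ∀ a ∈ S, |lam c Fd G ε x a.2.1 a.2.2.2.1 * lam c Fd G ε x a.2.2.1 a.2.2.2.2 / a.1| ≤
      Λ ^ 2 := by
    intro a ha
    have hp1 : (1 : ℝ) ≤ a.1 := by exact_mod_cast (hP a.1 (hmem a ha).1.1).1.one_lt.le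
    rw [abs_div, abs_of_pos (show (0 : ℝ) < a.1 by linarith), abs_mul, sq]
    calc |lam c Fd G ε x a.2.1 a.2.2.2.1| * |lam c Fd G ε x a.2.2.1 a.2.2.2.2| / a.1
        ≤ |lam c Fd G ε x a.2.1 a.2.2.2.1| * |lam c Fd G ε x a.2.2.1 a.2.2.2.2| :=
          div_le_self (mul_nonneg (abs_nonneg _) (abs_nonneg _)) hp1
      _ ≤ Λ * Λ := mul_le_mul (hΛ _ _) (hΛ _ _) (abs_nonneg _) hΛ0
  have hmain := sum_mul_rad_le S coord ⌊(x : ℝ) ^ (1 / 5 : ℝ) * y ε x ^ (2 * (k + 1))⌋₊ hsq hM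
    hinj hf (w := fun a => lam c Fd G ε x a.2.1 a.2.2.2.1 * lam c Fd G ε x a.2.2.1 a.2.2.2.2 / a.1)
    (sq_nonneg Λ) hw
  refine hmain.trans (le_of_eq ?_)
  congr 1
  refine Finset.sum_congr rfl fun r _ => ?_
  congr 2
  simp only [Fintype.card_option, Fintype.card_sum, Fintype.card_fin]
  ring

/-- **The class error terms are `≪_A x (log x)^{−A}`.**  For `0 ≤ ε ≤ 1/2` and every `A > 0` there
is `C` such that for all large `x`, every `i` and every finite set `P` of primes `≤ y`:
`Σ_{p ∈ P} (1/p) Σ_{d,d',e,e' ∈ rbox} |λ_{d,e} λ_{d',e'}| · 2E*(x; r_p) ≤ C x/(log x)^A`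
(Bombieri–Vinogradov at level `x^{1/4}`, the moduli being `≤ x^{1/5} y^{2k+2} ≤ x^{1/4}`).
[cite: Maynard2016LargeGaps, Lemma 7 (proof, displays (6.29)–(6.31) and before (6.33))] -/
theorem exists_eventually_classErrorSum_le {J : ℕ} {c : Fin J → ℝ} {Fd : Fin k → Fin J → ℝ → ℝ}
    {G : ℝ → ℝ} (hD : IsSieveData k J c Fd G) {ε : ℝ} (hε0 : 0 ≤ ε) (hε : ε ≤ 1 / 2) {A : ℝ}
    (hA : 0 < A) :
    ∃ C : ℝ, ∀ᶠ x : ℕ in atTop, ∀ i : Fin k, ∀ P : Finset ℕ, (∀ p ∈ P, p.Prime ∧ (p : ℝ) ≤ y ε x) →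
      ∑ p ∈ P, (1 / (p : ℝ)) * ∑ d ∈ rbox k x i, ∑ d' ∈ rbox k x i, ∑ e ∈ rbox k x i,
          ∑ e' ∈ rbox k x i, |lam c Fd G ε x d e * lam c Fd G ε x d' e'| *
            (2 * primeCountingAPErrMax x (radP p d d' e e')) ≤ C * x / Real.log x ^ A := by
  obtain ⟨Λ, hΛ0, hΛ⟩ := exists_abs_lam_le hD
  obtain ⟨C₀, hC₀⟩ := exists_eventually_sum_subset_errMax_le (θ := 1 / 4) (by norm_num)
    (K := (2 : ℝ) ^ (4 * k + 1)) (by positivity) hA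
  refine ⟨Λ ^ 2 * (2 * C₀), ?_⟩
  filter_upwards [hC₀, eventually_iteratedLogs, eventually_rpow_mul_y_pow_le (k + 1) hε0]
    with x hx hlogs hgrow i P hP
  obtain ⟨hL, hL₂, hL₃, -, hL₂L, -, -⟩ := hlogs
  have hlogx : 0 < Real.log x := by linarith
  have hlogy : 0 < Real.log (y ε x) := log_y_pos hε (by linarith) (by linarith) hL₃
  have h1 := classErrorSum_le_of_abs_lam_le hD hlogx hlogy i x hΛ0
    (fun d e => hΛ ε x d e hlogx hlogy) P hP
  refine h1.trans ?_
  have hsub : (Finset.Icc 1 ⌊(x : ℝ) ^ (1 / 5 : ℝ) * y ε x ^ (2 * (k + 1))⌋₊).filter Squarefree ⊆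
      Finset.Icc 1 ⌊(x : ℝ) ^ (1 / 4 : ℝ)⌋₊ :=
    (Finset.filter_subset _ _).trans (Finset.Icc_subset_Icc le_rfl (Nat.floor_mono hgrow))
  have h2 := hx _ hsub
  have h3 : ∑ r ∈ (Finset.Icc 1 ⌊(x : ℝ) ^ (1 / 5 : ℝ) * y ε x ^ (2 * (k + 1))⌋₊).filter Squarefree,
      ((2 : ℝ) ^ (4 * k + 1)) ^ ω r * (2 * primeCountingAPErrMax x r) =
        2 * ∑ r ∈ (Finset.Icc 1 ⌊(x : ℝ) ^ (1 / 5 : ℝ) * y ε x ^ (2 * (k + 1))⌋₊).filter Squarefree,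
          ((2 : ℝ) ^ (4 * k + 1)) ^ ω r * primeCountingAPErrMax x r := by
    rw [Finset.mul_sum]
    refine Finset.sum_congr rfl fun r _ => ?_
    ring
  rw [h3]
  calc Λ ^ 2 * (2 * ∑ r ∈ (Finset.Icc 1 ⌊(x : ℝ) ^ (1 / 5 : ℝ) * y ε x ^ (2 * (k + 1))⌋₊).filter
          Squarefree, ((2 : ℝ) ^ (4 * k + 1)) ^ ω r * primeCountingAPErrMax x r)
      ≤ Λ ^ 2 * (2 * (C₀ * x / Real.log x ^ A)) :=
        mul_le_mul_of_nonneg_left (mul_le_mul_of_nonneg_left h2 zero_le_two) (sq_nonneg Λ)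
    _ = Λ ^ 2 * (2 * C₀) * x / Real.log x ^ A := by ring

end Maynard2016

end Literature.NumberTheory.Sieve

end
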